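import Literature.NumberTheory.EllipticCurves.LevelLoweringGamma0AtThreeGeneralLevel
import HarnessLib

/-!
# Level lowering at `p = 3` in `Γ₀(N(ρ̄)·3^δ)`-newform currency when the optimal level DROPS at additive
# places of Kodaira type `IV`, `IV*` (Ribet 1990 / Diamond 1995 Thm. 6.4 – Cor. 6.5 / Darmon–Diamond–Taylor
# Thm. 3.15 + Lemma 2.7 + Silverman ATAEC IV.10.3; non-semistable case, dropping additive exponents)

Topic `NumberTheory/EllipticCurves`; namespace `Literature.NumberTheory.EllipticCurves`. ONE named fact
(`def … : Prop`, nothing asserted, nothing admitted) + its `Iff.rfl` unfolding lemma. Sibling of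
`ribet1990_levelLowering_gamma0_newform_at_three_general` (module `LevelLoweringGamma0AtThreeGeneralLevel`): there the
Kodaira clause «`3 ∤ #Φ_v(𝔽̄_v)` at EVERY additive place» makes the optimal level `N(ρ̄)·3^δ` keep the whole
additive part of the conductor. HERE the additive places split into those with `3 ∤ #Φ_v(𝔽̄_v)` (exponent kept)
and the squarefree set `A` of those with `3 ∣ #Φ_v(𝔽̄_v)` — Kodaira type `IV` or `IV*` — where Serre's exponent is
`f_v − 1`: the optimal level is `M₁ = N/(D·A)` (`D` the removed unramified multiplicative primes as before). The
congruence `a_p(g) ≡ a_p(f_E)` is asserted only OFF `D·A` (at `ℓ ∣ A` one has `a_ℓ(f_E) = 0` while `a_ℓ(g) = ±1`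
when `ℓ ∥ M₁`; no clause is made there). Consumer (cell `bsd-addord`, item `stmt-BirchSwinnertonDyer-19679`, stub
`stub_nonAdditive`, road (b^k,add) «`ℓ`-depletion at the dropped additive primes»): the rows whose Tamagawa `3`
sits at a multiplicative prime but which have an additive `IV`/`IV*` place with `c = 1`.

## What is packaged, and why every clause is in print

For an elliptic curve `E/ℚ` (globally minimal model `W₀`, conductor `N = M₁·A·D` with `9 ∤ N`; `D`, `A` squarefree,
`D` prime to `M₁·A`; every prime of `A` additive, `p² ∣ N`) with `ρ̄ = ρ̄_{E,3}` SURJECTIVE, `3 ∣ ord_r(Δ)` for every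
prime `r ∣ D`, `3 ∤ ord_p(Δ)` at every multiplicative `p ∣ M₁` (`p ∥ N`, `p ≠ 3`), `3 ∤ ord_3(Δ)` if `3 ∣ M₁`, and, at
the additive places `v`, `3 ∣ #Φ_v(𝔽̄_v)` EXACTLY for the primes of `A`:

1. Multiplicative primes and `δ(ρ̄)`: as in the siblings (Tate curve, [cite: Stevens1997OverviewFLT, Thm. (2.11)]
   [cite: DarmonDiamondTaylor1995, Prop. 2.12 (c), (d)] [cite: Edixhoven1997, §1 (1.6), §2]).
2. Additive places `v ∤ 3`, prime `ℓ`: Serre's exponent is `m_ℓ(ρ̄) = f_ℓ(E) − dim E[3]^{I_ℓ}`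
   [cite: DarmonDiamondTaylor1995, §2.1 (p. 54), Lemma 2.7 and Remark 2.14]
   [cite: SilvermanATAEC1994, §IV.10 Definition (p. 380) and Thm. 10.2 (a)] (the wild parts of `ρ̄` and of `E`
   coincide, the latter being computed on `E[3]`; `V₃E^{I_ℓ} = 0`). Now `E[3]^{I_ℓ} = E(ℚ_ℓ^{nr})[3] ≅ Φ_ℓ(𝔽̄_ℓ)[3]`:
   by Kodaira–Néron `E(ℚ_ℓ^{nr})/E₀(ℚ_ℓ^{nr}) ≅ Φ_ℓ(𝔽̄_ℓ)` [cite: SilvermanATAEC1994, Cor. IV.9.2 (b), (d) with Table 4.1]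
   and `E₀(ℚ_ℓ^{nr})` is uniquely `3`-divisible at an additive place `ℓ ≠ 3` (formal group pro-`ℓ`,
   `Ẽ_ns(𝔽̄_ℓ) = 𝔾_a`) [cite: SilvermanAEC2009, Prop. VII.2.1, Prop. IV.3.2 (b), Prop. III.2.5]. Hence at `3 ∤ #Φ_ℓ(𝔽̄_ℓ)`
   the exponent is kept (`m_ℓ = f_ℓ`, the sibling's clause), while at `3 ∣ #Φ_ℓ(𝔽̄_ℓ)` — for an additive type this
   is `#Φ = 3`, type `IV` or `IV*`, potentially GOOD reduction (integral `j`) — one has `dim E[3]^{I_ℓ} ≥ 1`, and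
   `≤ 1` because `E[3]` unramified at `ℓ` would force good reduction [cite: SilvermanATAEC1994, Prop. IV.10.3 (a)]:
   `m_ℓ(ρ̄) = f_ℓ − 1`. So `N(ρ̄)·3^{δ(ρ̄)} = N/(D·A) = M₁`.
3. Darmon–Diamond–Taylor's Theorem 3.15 (`ℓ = 3` under «`ρ̄|_{G_{ℚ(√−3)}}` absolutely irreducible», automatic for
   surjective `ρ̄`; no hypothesis on `N(ρ̄)`) [cite: DarmonDiamondTaylor1995, Thm. 3.15]
   [cite: Diamond1995RefinedSerre, Thm. 6.4 and Cor. 6.5] [cite: Ribet1990, Thm. 1.1]: a weight-two NEWFORM `g` of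
   level `M₁` with `ρ̄ ≅ ρ̄_g` and character of order prime to `3`, hence trivial.
4. Congruences OFF `D·A` and the Tate clause ON `D`: verbatim as in the sibling (traces at `p ∤ 3N`; Carayol at
   `p ∥ M₁` [cite: Carayol1986, Thm. (A)]; [cite: Edixhoven1992, Thms. 2.5–2.6] at `3`; Atkin–Lehner `a_p = 0` at the
   KEPT additive primes `p² ∣ M₁` [cite: AtkinLehner1970, Thm. 3]; [cite: DarmonDiamondTaylor1995, Prop. 2.12 (b),
   Prop. 1.5 and (1.1.4)] on `D`). NO clause at the primes of `A`.

PRINT vs. CONSUMER: nothing requested is dropped. The sibling (`A = 1`) is the special case with empty `A`.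
-- TODO(general form): the value of `a_ℓ(g)` at `ℓ ∣ A` (`= χ(Frob_ℓ)` for `ρ_g|_{G_ℓ} = χ ⊗ St` when `ℓ ∥ M₁`; its
-- reduction is read on `Φ_ℓ(𝔽̄_ℓ)[3] = E[3]^{I_ℓ}`: `a_ℓ(g) ≡ ℓ` iff `c_ℓ = 3`) — needed for the rows whose
-- Tamagawa `3` sits AT the additive place; and `p ≥ 5`, additive `3`.

## References

* H. Darmon, F. Diamond, R. Taylor, *Fermat's Last Theorem*, CDM 1995, 1–154: §2.1 (p. 54), Lemma 2.7, Prop. 1.5,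
  (1.1.4), Prop. 2.12, Remark 2.14, Thm. 3.15 (p. 91). [DarmonDiamondTaylor1995]
* F. Diamond, *The refined conjecture of Serre* (1995), Thm. 6.4, Cor. 6.5. [Diamond1995RefinedSerre]
* K. A. Ribet, Invent. Math. 100 (1990), Thm. 1.1. [Ribet1990]
* B. Edixhoven, in Cornell–Silverman–Stevens (1997), §1 (1.6), §2, Thm. 3.1 [Edixhoven1997]; Invent. Math. 109 (1992),
  Thms. 2.5–2.6 [Edixhoven1992]. G. Stevens, ibid., Thm. (2.11). [Stevens1997OverviewFLT]
* J. H. Silverman, *Advanced Topics*, GTM 151 (1994), Cor. IV.9.2, Table 4.1, §IV.10 Definition (p. 380), Thm. 10.2,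
  Prop. 10.3 (a). [SilvermanATAEC1994] J. H. Silverman, *AEC* 2nd ed. (2009), III.2.5, IV.3.2, VII.2.1. [SilvermanAEC2009]
* A. O. L. Atkin, J. Lehner, Math. Ann. 185 (1970), Thm. 3. [AtkinLehner1970] H. Carayol, Ann. Sci. ÉNS 19 (1986),
  Thm. (A). [Carayol1986]
-/

noncomputable section

open scoped MatrixGroups ModularForm

open CongruenceSubgroup WeierstrassCurve Literature.NumberTheory.EllipticCurves.ModularForms IsDedekindDomain
  Rat.HeightOneSpectrum

namespace Literature.NumberTheory.EllipticCurves

/-- **Level lowering in `Γ₀(N(ρ̄)·3^δ)`-newform currency, `p = 3`, with the optimal level DROPPING by one at the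
additive places of Kodaira type `IV`/`IV*`** (Ribet 1990 Thm. 1.1 in the weight-two packaging of
Darmon–Diamond–Taylor Thm. 3.15 = Diamond 1995 Thm. 6.4 / Cor. 6.5; exponent of `N(ρ̄)` at the additive places by
Darmon–Diamond–Taylor Lemma 2.7 / Silverman ATAEC §IV.10 with Kodaira–Néron and ATAEC Prop. IV.10.3 (a); see the
module docstring). For a globally minimal `W₀/ℚ`, elliptic, `ρ̄_{E,3}` SURJECTIVE, conductor `N = M₁·A·D` with
`9 ∤ N`, `D` and `A` squarefree, `D` prime to `M₁·A`, every prime of `A` additive (`p² ∣ N`), `3 ∣ ord_r(Δ)` for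
every prime `r ∣ D`, `3 ∤ ord_p(Δ)` for every prime `p ∣ M₁` with `p ∥ N`, `p ≠ 3`, `3 ∤ ord_3(Δ)` if `3 ∣ M₁`, and
at every additive place `v`: `3 ∣ #Φ_v(𝔽̄_v)` iff `p_v ∣ A` (so that `M₁ = N(ρ̄)·3^{δ(ρ̄)}`): for the newform
`f = D₀.f ∈ S₂(Γ₀(N))` of `W₀` and every `ι : ℚ̄₃ ≃+* ℂ` there is a NEWFORM `g ∈ S₂(Γ₀(M₁))` with
`a_p(g) ≡ a_p(f)` for every prime `p ∤ D·A` and `a_r(g) ≡ a_r(f)(r + 1)` for every prime `r ∣ D`, modulo the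
maximal ideal of `𝒪_{ℚ̄₃}` after transport by `ι⁻¹`.
[cite: DarmonDiamondTaylor1995, Thm. 3.15, Lemma 2.7, Remark 2.14 and Prop. 2.12]
[cite: Diamond1995RefinedSerre, Thm. 6.4 and Cor. 6.5] [cite: Ribet1990, Thm. 1.1] [cite: Edixhoven1997, Thm. 3.1]
[cite: SilvermanATAEC1994, §IV.10 Definition (p. 380), Thm. 10.2 (a), Prop. 10.3 (a), Cor. IV.9.2 with Table 4.1]
[cite: Stevens1997OverviewFLT, Thm. (2.11)] [cite: Carayol1986, Thm. (A)] [cite: AtkinLehner1970, Thm. 3] -/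
def ribet1990_levelLowering_gamma0_newform_at_three_additiveDrop : Prop :=
  ∀ (W₀ : WeierstrassCurve ℚ) [W₀.IsElliptic] [W₀.IsGloballyMinimal],
    W₀.HasSurjectiveModNGaloisRep 3 →
    ∀ {N M₁ A D : ℕ} [NeZero N] [NeZero M₁], M₁ * A * D = N → Squarefree D → Squarefree A →
      Nat.Coprime D (M₁ * A) → ¬ 3 ^ 2 ∣ N → N = W₀.conductorNorm ℤ →
      (∀ r : ℕ, r.Prime → r ∣ D → (3 : ℤ) ∣ padicValRat r W₀.Δ) →
      (∀ p : ℕ, p.Prime → p ∣ M₁ → ¬ p ^ 2 ∣ N → p ≠ 3 → ¬ (3 : ℤ) ∣ padicValRat p W₀.Δ) →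
      (3 ∣ M₁ → ¬ (3 : ℤ) ∣ padicValRat 3 W₀.Δ) →
      (∀ p : ℕ, p.Prime → p ∣ A → p ^ 2 ∣ N) →
      (∀ v : HeightOneSpectrum ℤ, W₀.HasAdditiveReductionAt v →
        (3 ∣ (W₀.kodairaSymbolAt v).componentGroupOrder ↔ natGenerator v ∣ A)) →
      ∀ (D₀ : ModularParametrizationData W₀ N) (ι : PadicAlgCl 3 ≃+* ℂ),
        ∃ g : CuspForm (Gamma0 M₁) 2, IsNewform0 g ∧
          (∀ p : ℕ, p.Prime → ¬ p ∣ D * A → Valued.v (ι.symm (cuspCoeff D₀.f p - cuspCoeff g p)) < 1) ∧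
          (∀ r : ℕ, r.Prime → r ∣ D → Valued.v (ι.symm (cuspCoeff g r - cuspCoeff D₀.f r * (r + 1))) < 1)

/-- Unfolding lemma (the fact is a `Prop`-valued definition; this is its statement).
[cite: DarmonDiamondTaylor1995, Thm. 3.15 and Lemma 2.7] [cite: SilvermanATAEC1994, Prop. IV.10.3 (a)]
[cite: Ribet1990, Thm. 1.1] -/
theorem ribet1990_levelLowering_gamma0_newform_at_three_additiveDrop_iff :
    ribet1990_levelLowering_gamma0_newform_at_three_additiveDrop ↔
      ∀ (W₀ : WeierstrassCurve ℚ) [W₀.IsElliptic] [W₀.IsGloballyMinimal],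
        W₀.HasSurjectiveModNGaloisRep 3 →
        ∀ {N M₁ A D : ℕ} [NeZero N] [NeZero M₁], M₁ * A * D = N → Squarefree D → Squarefree A →
          Nat.Coprime D (M₁ * A) → ¬ 3 ^ 2 ∣ N → N = W₀.conductorNorm ℤ →
          (∀ r : ℕ, r.Prime → r ∣ D → (3 : ℤ) ∣ padicValRat r W₀.Δ) →
          (∀ p : ℕ, p.Prime → p ∣ M₁ → ¬ p ^ 2 ∣ N → p ≠ 3 → ¬ (3 : ℤ) ∣ padicValRat p W₀.Δ) →
          (3 ∣ M₁ → ¬ (3 : ℤ) ∣ padicValRat 3 W₀.Δ) →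
          (∀ p : ℕ, p.Prime → p ∣ A → p ^ 2 ∣ N) →
          (∀ v : HeightOneSpectrum ℤ, W₀.HasAdditiveReductionAt v →
            (3 ∣ (W₀.kodairaSymbolAt v).componentGroupOrder ↔ natGenerator v ∣ A)) →
          ∀ (D₀ : ModularParametrizationData W₀ N) (ι : PadicAlgCl 3 ≃+* ℂ),
            ∃ g : CuspForm (Gamma0 M₁) 2, IsNewform0 g ∧
              (∀ p : ℕ, p.Prime → ¬ p ∣ D * A → Valued.v (ι.symm (cuspCoeff D₀.f p - cuspCoeff g p)) < 1) ∧
              (∀ r : ℕ, r.Prime → r ∣ D → Valued.v (ι.symm (cuspCoeff g r - cuspCoeff D₀.f r * (r + 1))) < 1) :=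
  Iff.rfl

end Literature.NumberTheory.EllipticCurves

end
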